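import Literature.GroupTheory.CombinatorialGroupTheory.RandomSclFreeGroupProofs
import Mathlib.Combinatorics.SimpleGraph.Connectivity.Connected
import HarnessLib

/-!
# Random rigidity of scl (Calegari–Walker 2013): proofs, part 22 — counting reduced words
under letter constraints ("Lemma P")

D. Calegari, A. Walker, *Random rigidity in the free group*, Geom. Topol. 17 (2013)
[CalegariWalker2013], §4.6 (Lemma 4.13): the probability that a random reduced word satisfies a
system of letter identifications is governed by the *rank* of the system. We prove the
precise combinatorial statement behind this: if a family of constraints
`w(p′) = w(p)⁻¹` (`(p, p′) ∈ cs`) is imposed on a reduced word `w ∈ F_n`, then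
`#{w ∈ F_n : w satisfies cs} ≤ 2k (2k−1)^{F−1}` where `F` is the number of connected components
of the constraint graph; and `2F ≤ 2n − V′` where `V′` is the number of constrained positions.

* **`card_filter_reduced_le_of_determined`** — abstract form: if the letters of the words of a
  set `S` are determined, position by position, by the letters at a set `Mn` of free positions
  to the left, then `#(F_n ∩ S) ≤ 2k(2k−1)^{|Mn|−1}`.
* **`card_filter_constraints_le`** — the constraint form, free positions = component minima.
* **`two_mul_card_minima_add_le`** — `2 |Mn| + V′ ≤ 2n`.
-/

noncomputable section

open Filter Topology

namespace Literature.GroupTheory.CombinatorialGroupTheory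

section ConstraintCount

open Finset

open scoped Classical

/-- **Abstract Lemma P.** Let `S` be a set of words of length `n` over `Fin k × Bool` and `Mn` a
set of positions such that for `w, w′ ∈ S` and every position `x`, if `w, w′` agree at all
positions of `Mn` that are `≤ x` then `w x = w′ x`. Then the number of *reduced* words in `S`
is at most `2k (2k−1)^{|Mn| − 1}`. (Scan the positions: a position outside `Mn` is determined by
the prefix, a position in `Mn` has at most `2k − 1` reduced continuations.)
[cite: CalegariWalker2013, Lemma 4.13 (mechanism)] -/
theorem card_filter_reduced_le_of_determined {k n : ℕ} (hk : 1 ≤ k)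
    (S : Finset (Fin n → Fin k × Bool)) (Mn : Finset (Fin n))
    (hD : ∀ w ∈ S, ∀ w' ∈ S, ∀ x : Fin n, (∀ m ∈ Mn, m ≤ x → w m = w' m) → w x = w' x) :
    ((reducedWords k n).filter fun w => w ∈ S).card ≤ 2 * k * (2 * k - 1) ^ (Mn.card - 1) := by
  set T := (reducedWords k n).filter fun w => w ∈ S with hT
  -- prefixes
  let pre : (x : ℕ) → x ≤ n → (Fin n → Fin k × Bool) → Fin x → Fin k × Bool :=
    fun x hx w i => w ⟨i, lt_of_lt_of_le i.2 hx⟩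
  -- branching numbers
  let b : ℕ → ℕ := fun x => if h : x < n then (if (⟨x, h⟩ : Fin n) ∈ Mn then
    (if x = 0 then 2 * k else 2 * k - 1) else 1) else 1
  -- `N x` = number of distinct prefixes of length `x`
  have hstep : ∀ x (hx : x + 1 ≤ n),
      (T.image (pre (x + 1) hx)).card ≤ b x * (T.image (pre x (by omega))).card := by
    intro x hx
    have hxn : x < n := by omega
    -- restriction map from prefixes of length `x+1` to prefixes of length `x`
    let r : (Fin (x + 1) → Fin k × Bool) → (Fin x → Fin k × Bool) := fun u i => u i.castSucc
    have hr : ∀ w : Fin n → Fin k × Bool, r (pre (x + 1) hx w) = pre x (by omega) w := by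
      intro w; rfl
    have himage : (T.image (pre (x + 1) hx)).image r = T.image (pre x (by omega)) := by
      rw [Finset.image_image]
      exact Finset.image_congr fun w _ => hr w
    rw [← himage]
    refine Finset.card_le_mul_card_image _ _ ?_
    intro u hu
    -- the fibre over `u`: prefixes of length `x+1` restricting to `u`; inject by the last letter
    have hinj : Set.InjOn (fun u' : Fin (x + 1) → Fin k × Bool => u' (Fin.last x))
        (((T.image (pre (x + 1) hx)).filter fun u' => r u' = u) : Set _) := by
      intro u₁ h₁ u₂ h₂ heq
      rw [Finset.coe_filter] at h₁ h₂
      funext i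
      rcases Fin.eq_castSucc_or_eq_last i with ⟨j, rfl⟩ | rfl
      · have e1 : u₁ j.castSucc = r u₁ j := rfl
        have e2 : u₂ j.castSucc = r u₂ j := rfl
        rw [e1, e2, h₁.2, h₂.2]
      · exact heq
    have hcard := Finset.card_le_card_of_injOn _ (fun u' hu' => Finset.mem_coe.mpr
      (Finset.mem_image_of_mem (fun u' : Fin (x + 1) → Fin k × Bool => u' (Fin.last x)) hu')) hinj
    refine hcard.trans ?_
    -- bound the set of last letters
    by_cases hM : (⟨x, hxn⟩ : Fin n) ∈ Mn
    · by_cases hx0 : x = 0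
      · -- at most `2k` letters
        subst hx0
        have hb : b 0 = 2 * k := by simp [b, hxn, hM]
        rw [hb]
        calc _ ≤ (Finset.univ : Finset (Fin k × Bool)).card := Finset.card_le_univ _
          _ = 2 * k := by simp [Fintype.card_prod, Fintype.card_bool, mul_comm]
      · -- at most `2k - 1` letters: the inverse of the letter at `x - 1` is excluded
        have hb : b x = 2 * k - 1 := by simp [b, hxn, hM, hx0]
        rw [hb]
        have hx1 : x - 1 < x := by omega
        set c : Fin k × Bool := u ⟨x - 1, hx1⟩ with hc
        have hsub : ((T.image (pre (x + 1) hx)).filter fun u' => r u' = u).image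
            (fun u' : Fin (x + 1) → Fin k × Bool => u' (Fin.last x)) ⊆
            Finset.univ.erase (c.1, !c.2) := by
          intro a ha
          rw [Finset.mem_image] at ha
          obtain ⟨u', hu', rfl⟩ := ha
          rw [Finset.mem_filter, Finset.mem_image] at hu'
          obtain ⟨⟨w, hw, rfl⟩, hru⟩ := hu'
          rw [hT, Finset.mem_filter, mem_reducedWords_iff, reduce_ofFn_eq_self_iff] at hw
          rw [Finset.mem_erase]
          refine ⟨?_, Finset.mem_univ _⟩
          intro heq
          -- `w (x) = inv (w (x-1))` contradicts reducedness
          have hcw : u ⟨x - 1, hx1⟩ = w ⟨x - 1, by omega⟩ := by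
            rw [← hru]; rfl
          have hlast : pre (x + 1) hx w (Fin.last x) = w ⟨x, hxn⟩ := rfl
          rw [hlast] at heq
          have h1 := hw.1 (x - 1) (by omega)
          have e : x - 1 + 1 = x := by omega
          have h2 : (w ⟨x - 1, by omega⟩).1 = (w ⟨x - 1 + 1, by omega⟩).1 →
              (w ⟨x - 1, by omega⟩).2 = (w ⟨x - 1 + 1, by omega⟩).2 := h1
          have h3 : w ⟨x - 1 + 1, by omega⟩ = w ⟨x, hxn⟩ := by
            congr 1; exact Fin.ext e
          rw [h3, heq, hc, hcw] at h2
          simp at h2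
        calc _ ≤ (Finset.univ.erase (c.1, !c.2)).card := Finset.card_le_card hsub
          _ = 2 * k - 1 := by
              rw [Finset.card_erase_of_mem (Finset.mem_univ _), Finset.card_univ,
                Fintype.card_prod, Fintype.card_fin, Fintype.card_bool]
              omega
    · -- determined: all last letters coincide
      have hb : b x = 1 := by simp [b, hxn, hM]
      rw [hb]
      apply Finset.card_le_one.mpr
      intro a ha a' ha'
      rw [Finset.mem_image] at ha ha'
      obtain ⟨u₁, hu₁, rfl⟩ := ha
      obtain ⟨u₂, hu₂, rfl⟩ := ha'
      rw [Finset.mem_filter, Finset.mem_image] at hu₁ hu₂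
      obtain ⟨⟨w₁, hw₁, rfl⟩, hru₁⟩ := hu₁
      obtain ⟨⟨w₂, hw₂, rfl⟩, hru₂⟩ := hu₂
      rw [hT, Finset.mem_filter] at hw₁ hw₂
      show w₁ ⟨x, hxn⟩ = w₂ ⟨x, hxn⟩
      apply hD w₁ hw₁.2 w₂ hw₂.2
      intro m hm hmx
      have hmx' : (m : ℕ) < x := by
        rcases lt_or_eq_of_le (show (m : ℕ) ≤ x from hmx) with h | h
        · exact h
        · exfalso; apply hM; convert hm; exact h.symm
      have e1 : w₁ m = r (pre (x + 1) hx w₁) ⟨m, hmx'⟩ := rfl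
      have e2 : w₂ m = r (pre (x + 1) hx w₂) ⟨m, hmx'⟩ := rfl
      rw [e1, e2, hru₁, hru₂]
  -- iterate
  have hiter : ∀ x (hx : x ≤ n), (T.image (pre x hx)).card ≤ ∏ y ∈ Finset.range x, b y := by
    intro x
    induction x with
    | zero =>
      intro hx
      rw [Finset.range_zero, Finset.prod_empty]
      apply Finset.card_le_one.mpr
      intro a _ a' _
      funext i; exact i.elim0
    | succ x ih =>
      intro hx
      rw [Finset.prod_range_succ, mul_comm]
      exact (hstep x hx).trans (Nat.mul_le_mul_left _ (ih (by omega)))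
  have hfull : T.card = (T.image (pre n le_rfl)).card := by
    rw [Finset.card_image_of_injective]
    intro w w' h
    funext i
    have := congr_fun h ⟨i, i.2⟩
    simpa [pre] using this
  rw [hfull]
  refine (hiter n le_rfl).trans ?_
  -- `∏ b ≤ 2k (2k-1)^{|Mn|-1}`
  have hk1 : 1 ≤ 2 * k - 1 := by omega
  have hprod : ∀ x, x ≤ n → ∏ y ∈ Finset.range x, b y ≤
      2 * k * (2 * k - 1) ^ ((Mn.filter fun m : Fin n => (m : ℕ) < x).card - 1) := by
    intro x
    induction x with
    | zero => intro _; simp; omega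
    | succ x ih =>
      intro hx
      rw [Finset.prod_range_succ]
      have hxn : x < n := by omega
      have ih' := ih (by omega)
      have hfilt : (Mn.filter fun m : Fin n => (m : ℕ) < x + 1) =
          (Mn.filter fun m : Fin n => (m : ℕ) < x) ∪
            (if (⟨x, hxn⟩ : Fin n) ∈ Mn then {⟨x, hxn⟩} else ∅) := by
        ext m
        simp only [Finset.mem_filter, Finset.mem_union]
        constructor
        · rintro ⟨hm, hlt⟩
          rcases Nat.lt_succ_iff_lt_or_eq.mp hlt with h | h
          · exact Or.inl ⟨hm, h⟩
          · right
            have : m = ⟨x, hxn⟩ := Fin.ext h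
            subst this
            simp [hm]
        · rintro (⟨hm, h⟩ | h)
          · exact ⟨hm, by omega⟩
          · by_cases hM : (⟨x, hxn⟩ : Fin n) ∈ Mn
            · simp [hM] at h; subst h; exact ⟨hM, by simp⟩
            · simp [hM] at h
      by_cases hM : (⟨x, hxn⟩ : Fin n) ∈ Mn
      · rw [if_pos hM] at hfilt
        have hdisj : Disjoint (Mn.filter fun m : Fin n => (m : ℕ) < x) {⟨x, hxn⟩} := by
          rw [Finset.disjoint_singleton_right, Finset.mem_filter]
          simp
        have hc : (Mn.filter fun m : Fin n => (m : ℕ) < x + 1).card =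
            (Mn.filter fun m : Fin n => (m : ℕ) < x).card + 1 := by
          rw [hfilt, Finset.card_union_of_disjoint hdisj, Finset.card_singleton]
        rw [hc]
        by_cases hx0 : x = 0
        · subst hx0
          have hb : b 0 = 2 * k := by simp [b, hxn, hM]
          have h0 : (Mn.filter fun m : Fin n => (m : ℕ) < 0).card = 0 := by simp
          rw [hb, h0]
          simp
        · have hb : b x = 2 * k - 1 := by simp [b, hxn, hM, hx0]
          rw [hb]
          -- there is a smaller element? not needed: use `ih'` and monotonicity
          have hpos : 1 ≤ (Mn.filter fun m : Fin n => (m : ℕ) < x).card ∨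
              (Mn.filter fun m : Fin n => (m : ℕ) < x).card = 0 := by omega
          rcases hpos with h1 | h0
          · calc (∏ y ∈ Finset.range x, b y) * (2 * k - 1)
                ≤ 2 * k * (2 * k - 1) ^ ((Mn.filter fun m : Fin n => (m : ℕ) < x).card - 1) *
                    (2 * k - 1) := Nat.mul_le_mul_right _ ih'
              _ = 2 * k * (2 * k - 1) ^ ((Mn.filter fun m : Fin n => (m : ℕ) < x).card + 1 - 1) := by
                  rw [show (Mn.filter fun m : Fin n => (m : ℕ) < x).card + 1 - 1 =
                    ((Mn.filter fun m : Fin n => (m : ℕ) < x).card - 1) + 1 by omega, pow_succ]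
                  ring
          · -- no free position before `x`: all prefixes of length `x` coincide, `∏ ≤ 1`?
            -- we only know `∏ ≤ 2k`; use `2k - 1 ≤ 2k`... bound: `∏_{y<x} b y = 1`
            have hone : ∏ y ∈ Finset.range x, b y = 1 := by
              apply Finset.prod_eq_one
              intro y hy
              rw [Finset.mem_range] at hy
              have hyn : y < n := by omega
              have hyM : (⟨y, hyn⟩ : Fin n) ∉ Mn := by
                intro hmem
                have : (⟨y, hyn⟩ : Fin n) ∈ Mn.filter fun m : Fin n => (m : ℕ) < x :=
                  Finset.mem_filter.mpr ⟨hmem, hy⟩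
                rw [Finset.card_eq_zero] at h0
                rw [h0] at this
                simp at this
              simp [b, hyn, hyM]
            rw [hone, h0]
            simp
      · rw [if_neg hM, Finset.union_empty] at hfilt
        rw [hfilt]
        have hb : b x = 1 := by simp [b, hxn, hM]
        rw [hb, mul_one]
        exact ih'
  refine (hprod n le_rfl).trans ?_
  have hMn : (Mn.filter fun m : Fin n => (m : ℕ) < n) = Mn := by
    apply Finset.filter_true_of_mem; intro m _; exact m.2
  rw [hMn]

/-- **Propagation along the constraint graph.** If `w, w′` both satisfy the constraints
`w c.2 = (w c.1)⁻¹` (`c ∈ cs`) and agree at `a`, they agree at every position reachable from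
`a` in the constraint graph. [folklore] -/
theorem eq_of_reachable_constraints {k n : ℕ} (cs : List (Fin n × Fin n))
    (w w' : Fin n → Fin k × Bool)
    (hw : ∀ c ∈ cs, w c.2 = ((w c.1).1, !(w c.1).2))
    (hw' : ∀ c ∈ cs, w' c.2 = ((w' c.1).1, !(w' c.1).2)) {a b : Fin n}
    (p : (SimpleGraph.fromRel fun x y : Fin n => (x, y) ∈ cs).Walk a b) (ha : w a = w' a) :
    w b = w' b := by
  induction p with
  | nil => exact ha
  | @cons u v _ hadj _ ih =>
    apply ih
    rw [SimpleGraph.fromRel_adj] at hadj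
    rcases hadj.2 with h | h
    · rw [hw (u, v) h, hw' (u, v) h, ha]
    · have h1 := hw (v, u) h
      have h2 := hw' (v, u) h
      simp only at h1 h2
      -- `w u = inv (w v)`, `w' u = inv (w' v)`, `w u = w' u`
      rw [ha] at h1
      have h3 : ((w v).1, !(w v).2) = ((w' v).1, !(w' v).2) := h1.symm.trans h2
      simp only [Prod.mk.injEq] at h3
      exact Prod.ext h3.1 (Bool.not_inj h3.2)

/-- **Lemma P (constraint form).** For a list of constraints `cs` on positions of words of length
`n` (`w c.2 = (w c.1)⁻¹`), with `Mn` the set of positions that are minimal in their connected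
component of the constraint graph: `#{w ∈ F_n : w satisfies cs} ≤ 2k (2k−1)^{|Mn|−1}`.
[cite: CalegariWalker2013, Lemma 4.13 (mechanism)] -/
theorem card_filter_constraints_le {k n : ℕ} (hk : 1 ≤ k) (cs : List (Fin n × Fin n)) :
    ((reducedWords k n).filter fun w => ∀ c ∈ cs, w c.2 = ((w c.1).1, !(w c.1).2)).card ≤
      2 * k * (2 * k - 1) ^ ((Finset.univ.filter fun x : Fin n =>
        ∀ y : Fin n, (SimpleGraph.fromRel fun x y : Fin n => (x, y) ∈ cs).Reachable x y →
          x ≤ y).card - 1) := by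
  set G := SimpleGraph.fromRel fun x y : Fin n => (x, y) ∈ cs with hG
  set Mn := Finset.univ.filter fun x : Fin n => ∀ y : Fin n, G.Reachable x y → x ≤ y with hMn
  set S : Finset (Fin n → Fin k × Bool) :=
    Finset.univ.filter fun w => ∀ c ∈ cs, w c.2 = ((w c.1).1, !(w c.1).2) with hS
  have hD : ∀ w ∈ S, ∀ w' ∈ S, ∀ x : Fin n, (∀ m ∈ Mn, m ≤ x → w m = w' m) → w x = w' x := by
    intro w hw w' hw' x hagree
    rw [hS, Finset.mem_filter] at hw hw'
    -- the minimum of the component of `x`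
    set R := Finset.univ.filter fun y : Fin n => G.Reachable x y with hR
    have hxR : x ∈ R := by rw [hR, Finset.mem_filter]; exact ⟨Finset.mem_univ _, .refl _⟩
    have hRne : R.Nonempty := ⟨x, hxR⟩
    set m := R.min' hRne with hm
    have hmR : m ∈ R := Finset.min'_mem R hRne
    rw [hR, Finset.mem_filter] at hmR
    have hmMn : m ∈ Mn := by
      rw [hMn, Finset.mem_filter]
      refine ⟨Finset.mem_univ _, fun y hy => ?_⟩
      apply Finset.min'_le
      rw [hR, Finset.mem_filter]
      exact ⟨Finset.mem_univ _, hmR.2.trans hy⟩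
    have hmx : m ≤ x := Finset.min'_le R x hxR
    have hma : w m = w' m := hagree m hmMn hmx
    obtain ⟨p⟩ := hmR.2.symm
    exact eq_of_reachable_constraints cs w w' hw.2 hw'.2 p hma
  have h := card_filter_reduced_le_of_determined hk S Mn hD
  have e : ((reducedWords k n).filter fun w => w ∈ S) =
      (reducedWords k n).filter fun w => ∀ c ∈ cs, w c.2 = ((w c.1).1, !(w c.1).2) := by
    ext w; simp [hS]
  rw [e] at h
  exact h

/-- **Few minima.** Twice the number of component-minimal positions plus the number of
constrained positions is at most `2n`: a constrained minimum has a neighbour, which is not a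
minimum, in its own component. [folklore] -/
theorem two_mul_card_minima_add_le {n : ℕ} (cs : List (Fin n × Fin n))
    (hcs : ∀ c ∈ cs, c.1 ≠ c.2) :
    2 * (Finset.univ.filter fun x : Fin n =>
        ∀ y : Fin n, (SimpleGraph.fromRel fun x y : Fin n => (x, y) ∈ cs).Reachable x y →
          x ≤ y).card +
      (Finset.univ.filter fun x : Fin n => ∃ c ∈ cs, x = c.1 ∨ x = c.2).card ≤ 2 * n := by
  set G := SimpleGraph.fromRel fun x y : Fin n => (x, y) ∈ cs with hG
  set Mn := Finset.univ.filter fun x : Fin n => ∀ y : Fin n, G.Reachable x y → x ≤ y with hMn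
  set V' := Finset.univ.filter fun x : Fin n => ∃ c ∈ cs, x = c.1 ∨ x = c.2 with hV'
  -- every constrained position has a neighbour
  have hnb : ∀ x ∈ V', ∃ y, G.Adj x y := by
    intro x hx
    rw [hV', Finset.mem_filter] at hx
    obtain ⟨c, hc, hxc⟩ := hx.2
    rcases hxc with rfl | rfl
    · exact ⟨c.2, by rw [hG, SimpleGraph.fromRel_adj]; exact ⟨hcs c hc, Or.inl (by simpa using hc)⟩⟩
    · exact ⟨c.1, by rw [hG, SimpleGraph.fromRel_adj]; exact ⟨(hcs c hc).symm, Or.inr (by simpa using hc)⟩⟩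
  -- choose a neighbour for each constrained minimum
  have key : (Mn ∩ V').card ≤ (V' \ Mn).card := by
    choose! nb hnb' using hnb
    refine Finset.card_le_card_of_injOn nb ?_ ?_
    · intro m hm
      rw [Finset.mem_coe, Finset.mem_inter] at hm
      have hadj := hnb' m hm.2
      rw [Finset.mem_coe, Finset.mem_sdiff]
      constructor
      · -- `nb m` is constrained
        rw [hG, SimpleGraph.fromRel_adj] at hadj
        rw [hV', Finset.mem_filter]
        refine ⟨Finset.mem_univ _, ?_⟩
        rcases hadj.2 with h | h
        · exact ⟨(m, nb m), by simpa using h, Or.inr rfl⟩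
        · exact ⟨(nb m, m), by simpa using h, Or.inl rfl⟩
      · -- `nb m` is not a minimum
        intro hmin
        rw [hMn, Finset.mem_filter] at hmin hm
        have h1 : nb m ≤ m := hmin.2 m hadj.symm.reachable
        have h2 : m ≤ nb m := hm.1.2 (nb m) hadj.reachable
        exact hadj.ne (le_antisymm h2 h1)
    · intro m hm m' hm' heq
      rw [Finset.mem_coe, Finset.mem_inter] at hm hm'
      have hadj := hnb' m hm.2
      have hadj' := hnb' m' hm'.2
      rw [heq] at hadj
      have hreach : G.Reachable m m' := hadj.reachable.trans hadj'.symm.reachable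
      rw [hMn, Finset.mem_filter] at hm hm'
      exact le_antisymm (hm.1.2 m' hreach) (hm'.1.2 m hreach.symm)
  have h1 : Mn.card = (Mn ∩ V').card + (Mn \ V').card := by
    rw [← Finset.card_inter_add_card_sdiff Mn V']
  have h2 : (Mn \ V').card ≤ (Finset.univ \ V').card :=
    Finset.card_le_card (Finset.sdiff_subset_sdiff (Finset.subset_univ _) le_rfl)
  have h3 : (Finset.univ \ V').card = n - V'.card := by
    rw [Finset.card_sdiff, Finset.inter_univ, Finset.card_univ, Fintype.card_fin]
  have h4 : (V' \ Mn).card + (Mn ∩ V').card ≤ V'.card := by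
    rw [Finset.inter_comm, ← Finset.card_sdiff_add_card_inter V' Mn]
  have h5 : V'.card ≤ n := by
    calc V'.card ≤ (Finset.univ : Finset (Fin n)).card := Finset.card_le_univ _
      _ = n := by simp
  omega

end ConstraintCount

end Literature.GroupTheory.CombinatorialGroupTheory

end
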